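import Literature.NumberTheory.ModularSymbols.CuspidalHomologyPrymFixedPointSpan
import Literature.NumberTheory.ModularSymbols.PeriodHomologyGroupPresentationProofs
import HarnessLib

/-!
# The Hilbert-90 defect of `X₀(N) → X₀(N/3)` is spanned by fixed-point symbols — UNCONDITIONALLY

Topic `Literature/NumberTheory/ModularSymbols`, a two-import leaf joining
`CuspidalHomologyPrymFixedPointSpan` (the theorem
`prymLattice_le_shiftSubOneLattice_sup_span_fixedPoint (H : periodFunctional_ker_le_ellipticParabolic_sup_commutator)`:
for `9 ∣ N`, `Λ_P = ker Nm ⊆ (t − 1)Λ + ℤ{ {∞, γ∞} : γ = (a b; c d) ∈ Γ₀(N), |3(a + d) − c| ≤ 6 }` in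
`Λ = H₁(X₀(N), ℤ)`, GRANTED Knapp's presentation of the period homology) with
`PeriodHomologyGroupPresentationProofs` (where that presentation, Knapp 1993 Prop. 11.22 —
`ker(γ ↦ {∞, γ∞}) ⊆ Γ_ep · [Γ₀(N), Γ₀(N)]` — is now the THEOREM
`periodFunctional_ker_le_ellipticParabolic_sup_commutator_holds`).  The hypothesis is discharged; nothing
else changes.  THEOREMS ONLY: no definition, no named fact, no instance, no `sorry`.

The second theorem is the statement of item E32a `PrymLatticeFixedPointSpan` of route `TameQuarticManinParity`
(stmt-BirchSwinnertonDyer-23756) verbatim, now without hypothesis; the Summit side closes such items by name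
in `Summits/…/Theorems/`, this file only records the Literature fact.  No summit statement is touched.

## References

* A. W. Knapp, *Elliptic Curves*, Princeton Math. Notes 40 (1993), Prop. 11.22 (PDF p. 242), (11.37), (11.42).
  [Knapp1993]
* Ju. I. Manin, *Parabolic points and zeta functions of modular curves* (1972), §1.5, Prop. 1.4. [Manin1972]
* H. Lange, R. E. Rodríguez, *Decomposition of Jacobians by Prym Varieties*, LNM 2310 (2022), §3.2.1
  (PDF p. 55). [LangeRodriguez2022]
-/

noncomputable section

open scoped MatrixGroups ModularForm

open CongruenceSubgroup
open Literature.NumberTheory.EllipticCurves.ModularForms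

namespace Literature.NumberTheory.ModularSymbols

/-- **The Prym lattice is spanned, modulo `(t − 1)Λ`, by the fixed-point symbols** (`9 ∣ N`), unconditionally:
`Λ_P ⊆ (t − 1)Λ + ℤ{ {∞, γ∞} : γ = (a b; c d) ∈ Γ₀(N), |3(a + d) − c| ≤ 6 }` in `Λ = H₁(X₀(N), ℤ)` — the
tree's `prymLattice_le_shiftSubOneLattice_sup_span_fixedPoint` fed Knapp's presentation
`periodFunctional_ker_le_ellipticParabolic_sup_commutator_holds` (Prop. 11.22: a `γ ∈ Γ₀(N)` with zero
periods lies in `Γ_ep · [Γ₀(N), Γ₀(N)]`).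
[cite: Knapp1993, Prop. 11.22 (PDF p. 242)] [cite: Manin1972, §1.5 and Prop. 1.4] -/
theorem prymLattice_le_shiftSubOneLattice_sup_span_fixedPoint_holds (N : ℕ) [NeZero N] (h9 : 3 ^ 2 ∣ N) :
    prymLattice N h9 ≤ shiftSubOneLattice N h9 ⊔ Submodule.span ℤ {x | ∃ γ : Gamma0 N,
      |3 * ((γ : SL(2, ℤ)) 0 0 + (γ : SL(2, ℤ)) 1 1) - (γ : SL(2, ℤ)) 1 0| ≤ 6 ∧ symbolInt N γ = x} :=
  prymLattice_le_shiftSubOneLattice_sup_span_fixedPoint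
    periodFunctional_ker_le_ellipticParabolic_sup_commutator_holds N h9

/-- **Item E32a `PrymLatticeFixedPointSpan` (stmt-BirchSwinnertonDyer-23756), its statement VERBATIM, now
unconditional**: for every `N` with `9 ∣ N`,
`prymLattice N h9 ≤ shiftSubOneLattice N h9 ⊔ span ℤ {symbolInt N γ : |3(γ₀₀ + γ₁₁) − γ₁₀| ≤ 6}` — the tree's
`prymLatticeFixedPointSpan_of_periodKernelFact` fed `periodFunctional_ker_le_ellipticParabolic_sup_commutator_holds`.
[cite: Knapp1993, Prop. 11.22 (PDF p. 242)] [cite: Manin1972, §1.5 and Prop. 1.4] -/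
theorem prymLatticeFixedPointSpan_holds :
    ∀ (N : ℕ) [NeZero N] (h9 : 3 ^ 2 ∣ N), prymLattice N h9 ≤ shiftSubOneLattice N h9 ⊔
      Submodule.span ℤ {x | ∃ γ : CongruenceSubgroup.Gamma0 N,
        |3 * ((γ : Matrix.SpecialLinearGroup (Fin 2) ℤ).1 0 0 + (γ : Matrix.SpecialLinearGroup (Fin 2) ℤ).1 1 1) -
          (γ : Matrix.SpecialLinearGroup (Fin 2) ℤ).1 1 0| ≤ 6 ∧ symbolInt N γ = x} :=
  prymLatticeFixedPointSpan_of_periodKernelFact periodFunctional_ker_le_ellipticParabolic_sup_commutator_holds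

end Literature.NumberTheory.ModularSymbols

end
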